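import Summits.HubbardSuperconductivity.HubbardSuperconductivity.Theorems.FunctionFieldCertificateWindowInfraredBoundFreeFermiSea
import Summits.HubbardSuperconductivity.HubbardSuperconductivity.Theorems.WindowGap.Negative.FreeWindowCalibration
import Summits.HubbardSuperconductivity.HubbardSuperconductivity.Theorems.WindowInfraredBound.Negative.ParsevalCeiling

/-!
# Crux `WindowInfraredBound` (stmt-HubbardSuperconductivity-1089) — the free point `U = 0`, file 2/2:
# the crux body HOLDS (flat law `C ε² L²`) in EVERY sector and for EVERY ground state,
# degenerate open shells included

Calibration R4 of `Cruxes/WindowInfraredBound/STRATEGY-CENSUS.md` §5(iv)/§7 (`FreeWindowBoundAllGroundStates`):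
`Disproof.lean` §4.3 checked the window functional numerically along ONE Slater ground state, and
`WindowGap.Negative.FreeWindowCalibration` bounds only the ground-projection AVERAGE; here the bound is proved
for every vector of the (possibly exponentially degenerate) free sector ground space, from the sharp Fermi seas
of file 1/2 (`…FreeFermiSea.lean`):

* `free_eucNorm_pairFieldAt_dWave_mulVec_le` — `‖Δ_d(m) ψ‖ ≤ 3√50 · L · ‖ψ‖` for every sector ground state
  and EVERY pair momentum `m` (`Δ_d(m) = −Σ_k A_m(k) c_{(m−k)↓}c_{k↑}`, `|A_m(k)|² ≤ 50`,
  `pairFieldAt_eq_neg_sum_smul_pairModeAt`; sea + shell `≤ 2L`); hence `free_pairStructureFactor_le`: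
  `S_ψ(m) ≤ 450` — a flat pair structure factor at every momentum;
* `windowInfraredBound_free_allGroundStates` — the crux's window tail obeys
  `T_ε(ψ) = Σ_{m ≠ 0, |q_m| ≤ ε} S_ψ(m) ≤ 113 · ε² · L²` for every `ε > 0`, `L ≥ 3`, every `(N, S^z)` and
  every normalised sector ground state (`card_window_le`; `450 · 9/(4π²) < 113`);
* `windowInfraredBoundBody_at_zero` (registered) — the crux `WindowInfraredBound` with `∀ U, 0 < U →`
  replaced by `U := 0` and `δ ∈ (0,1/2)` dropped is TRUE, witnesses `C = 113`, `ε₀ = 1`, `L₀ = 3`: at the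
  free point the hypothesis `0 < U` is idle and the metallic FLAT law holds over the whole degenerate ground
  space (contrast `WindowGap.Negative.not_windowGapAt_zero`: the sibling crux `WindowGap` is FALSE at `U = 0`).

Sources: J. Bardeen, L. N. Cooper, J. R. Schrieffer, Phys. Rev. 108 (1957) 1175, §II; C. N. Yang,
Rev. Mod. Phys. 34 (1962) 694, §3; T. Kennedy, E. H. Lieb, B. S. Shastry, PRL 61 (1988) 2582 (structure
factor and window). Folklore finite-dimensional statements; no definition and no named fact is introduced.
-/

noncomputable section

-- the mandated namespace repeats `HubbardSuperconductivity` (single-problem summit, D-0017)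
set_option linter.dupNamespace false

namespace Summit.HubbardSuperconductivity.HubbardSuperconductivity.Theorems.WindowInfraredBound

open Matrix Finset
open Literature.Probability.LatticeModels Literature.MathematicalPhysics.QuantumLattice
open scoped ComplexOrder ComplexConjugate

/-! ## §4 The `d`-wave pair field of a free sector ground state: `‖Δ_d(m)ψ‖² ≤ 450 L²` -/

section PairField

variable {L : ℕ} [NeZero L]

open Summit.HubbardSuperconductivity.HubbardSuperconductivity.Theorems.WindowGap.Negative
  (pairFieldAt_eq_neg_sum_smul_pairModeAt normSq_pairModeAtCoeff_dWave_le card_window_le)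

/-- **`‖Δ_d(m) ψ‖ ≤ 3√50 · L · ‖ψ‖` for every sector ground state of the free torus and EVERY pair momentum
`m`** (`L ≥ 3`): `Δ_d(m) = −Σ_k A_m(k) c_{(m−k)↓}c_{k↑}` with `|A_m(k)|² ≤ 50`
(`pairFieldAt_eq_neg_sum_smul_pairModeAt`, `normSq_pairModeAtCoeff_dWave_le`), the sharp Fermi seas of
`free_groundState_seaStructure`, the thin shell of `free_shell_card_le`, and `free_eucNorm_modeSum_mulVec_le`.
Bardeen–Cooper–Schrieffer (1957) §II; Yang (1962) §3. [folklore] -/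
theorem free_eucNorm_pairFieldAt_dWave_mulVec_le (hL : 3 ≤ L) {N : ℕ} {M : ℝ}
    {ψ : Fock (Orb (FermionTorus 2 L))} (hψ : IsGroundStateInSector (hubbardTorus 2 L 1 0) N M ψ)
    (m : TorusSite 2 L) :
    eucNorm (pairFieldAt dWaveFormFactor L m *ᵥ ψ) ≤ Real.sqrt 50 * (3 * L) * eucNorm ψ := by
  classical
  -- fillings and the forced-filled / forced-empty momenta per spin
  set ν : Fin 2 → ℝ := fun σ => (N : ℝ) / 2 + (if σ = 0 then M else -M) with hν
  set F : Fin 2 → Finset (TorusSite 2 L) := fun σ => Finset.univ.filter fun k : TorusSite 2 L =>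
      (((Finset.univ.filter fun k' : TorusSite 2 L => torusBand L k' ≤ torusBand L k).card : ℕ) : ℝ) ≤ ν σ
    with hF
  set E : Fin 2 → Finset (TorusSite 2 L) := fun σ => Finset.univ.filter fun k : TorusSite 2 L =>
      ν σ ≤ (((Finset.univ.filter fun k' : TorusSite 2 L => torusBand L k' < torusBand L k).card : ℕ) : ℝ)
    with hE
  have hFψ : ∀ σ, ∀ k ∈ F σ, momentumNumber k σ *ᵥ ψ = ψ := by
    intro σ k hk
    rw [hF, Finset.mem_filter] at hk
    exact (free_groundState_seaStructure hL hψ σ k).1 hk.2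
  have hEψ : ∀ σ, ∀ k ∈ E σ, momentumNumber k σ *ᵥ ψ = 0 := by
    intro σ k hk
    rw [hE, Finset.mem_filter] at hk
    exact (free_groundState_seaStructure hL hψ σ k).2 hk.2
  -- the `↑`-shell has at most `2L` points
  have hshell : ((((F 0 ∪ E 0)ᶜ).card : ℕ) : ℝ) ≤ 2 * L := by
    have hset : (F 0 ∪ E 0)ᶜ = Finset.univ.filter fun k : TorusSite 2 L =>
        ¬ ((((Finset.univ.filter fun k' : TorusSite 2 L => torusBand L k' ≤ torusBand L k).card : ℕ) : ℝ) ≤ ν 0) ∧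
        ¬ (ν 0 ≤ (((Finset.univ.filter fun k' : TorusSite 2 L => torusBand L k' < torusBand L k).card : ℕ) : ℝ)) := by
      ext k
      simp only [hF, hE, Finset.mem_compl, Finset.mem_union, Finset.mem_filter, Finset.mem_univ, true_and, not_or]
    rw [hset]
    exact free_shell_card_le (ν 0)
  -- the coefficient profile of `Δ_d(m)`
  set A : TorusSite 2 L → ℂ := fun k => ∑ e ∈ insert 0 unitSteps, ((dWaveFormFactor e / Real.sqrt 2 : ℝ) : ℂ) *
      (torusChar (m - k) (Torus.proj L e) + torusChar k (Torus.proj L e)) with hA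
  have hA50 : ∀ k, ‖A k‖ ^ 2 ≤ 50 := fun k => by
    rw [← Complex.normSq_eq_norm_sq]
    exact normSq_pairModeAtCoeff_dWave_le m k
  have hΔ : pairFieldAt dWaveFormFactor L m =
      -∑ k : TorusSite 2 L, A k • (momentumAnnihilation (m - k) 1 * momentumAnnihilation k 0) :=
    pairFieldAt_eq_neg_sum_smul_pairModeAt dWaveFormFactor m
  rw [hΔ, neg_mulVec, eucNorm_neg]
  calc eucNorm ((∑ k : TorusSite 2 L, A k • (momentumAnnihilation (m - k) 1 * momentumAnnihilation k 0)) *ᵥ ψ)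
      ≤ Real.sqrt 50 * ((L : ℝ) + 2 * L) * eucNorm ψ :=
        free_eucNorm_modeSum_mulVec_le m A (by norm_num) hA50 F E ψ hFψ hEψ hshell
    _ = Real.sqrt 50 * (3 * L) * eucNorm ψ := by ring

/-- **Flat pair structure factor at the free point, every ground state**: `S_ψ(m) ≤ 450` for every
normalised sector ground state `ψ` of `hubbardTorus 2 L 1 0` (`L ≥ 3`), every `(N, S^z)` and every momentum
label `m` (`S = pairStructureFactor dWaveFormFactor`). Bardeen–Cooper–Schrieffer (1957) §II. [folklore] -/
theorem free_pairStructureFactor_le (hL : 3 ≤ L) {N : ℕ} {M : ℝ} {ψ : Fock (Orb (FermionTorus 2 L))}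
    (hψ : IsGroundStateInSector (hubbardTorus 2 L 1 0) N M ψ) (hψ1 : star ψ ⬝ᵥ ψ = 1)
    (m : TorusSite 2 L) : pairStructureFactor dWaveFormFactor L ψ m ≤ 450 := by
  have hLpos : (0 : ℝ) < L := Nat.cast_pos.2 (Nat.pos_of_ne_zero (NeZero.ne L))
  have h := free_eucNorm_pairFieldAt_dWave_mulVec_le hL hψ m
  rw [eucNorm_eq_one hψ1, mul_one] at h
  have h2 : eucNorm (pairFieldAt dWaveFormFactor L m *ᵥ ψ) ^ 2 ≤ (Real.sqrt 50 * (3 * L)) ^ 2 :=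
    pow_le_pow_left₀ (eucNorm_nonneg _) h 2
  rw [mul_pow, Real.sq_sqrt (by norm_num), eucNorm_sq] at h2
  rw [pairStructureFactor_apply, div_le_iff₀ (by positivity)]
  nlinarith [h2]

end PairField

/-! ## §5 The crux's window functional at the free point -/

section Window

variable {L : ℕ} [NeZero L]

open Summit.HubbardSuperconductivity.HubbardSuperconductivity.Theorems.WindowGap.Negative (card_window_le)
open Summit.HubbardSuperconductivity.HubbardSuperconductivity.Theorems.WindowInfraredBound.Negative
  (one_le_sum_valMinAbs_sq)

/-- The window tail of a free sector ground state is at most `450 · #{m : |q_m| ≤ ε}`. [folklore] -/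
theorem free_windowSum_le_card (hL : 3 ≤ L) {N : ℕ} {M : ℝ} {ψ : Fock (Orb (FermionTorus 2 L))}
    (hψ : IsGroundStateInSector (hubbardTorus 2 L 1 0) N M ψ) (hψ1 : star ψ ⬝ᵥ ψ = 1) (ε : ℝ) :
    (∑ m : TorusSite 2 L, if m ≠ 0 ∧ momentumNormSq L m ≤ ε ^ 2 then
        pairStructureFactor dWaveFormFactor L ψ m else 0) ≤
      450 * ((Finset.univ.filter fun m : TorusSite 2 L => momentumNormSq L m ≤ ε ^ 2).card : ℝ) := by
  classical
  calc (∑ m : TorusSite 2 L, if m ≠ 0 ∧ momentumNormSq L m ≤ ε ^ 2 then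
        pairStructureFactor dWaveFormFactor L ψ m else 0)
      ≤ ∑ m : TorusSite 2 L, if momentumNormSq L m ≤ ε ^ 2 then (450 : ℝ) else 0 := by
        refine Finset.sum_le_sum fun m _ => ?_
        by_cases h1 : m ≠ 0 ∧ momentumNormSq L m ≤ ε ^ 2
        · rw [if_pos h1, if_pos h1.2]
          exact free_pairStructureFactor_le hL hψ hψ1 m
        · rw [if_neg h1]
          split_ifs <;> norm_num
    _ = 450 * ((Finset.univ.filter fun m : TorusSite 2 L => momentumNormSq L m ≤ ε ^ 2).card : ℝ) := by
        rw [Finset.sum_ite, Finset.sum_const_zero, add_zero, Finset.sum_const, nsmul_eq_mul, mul_comm]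

/-- **The window infrared bound at the free point, FLAT law, every sector, every ground state.**
For `L ≥ 3`, every `(N, S^z = M)`, every normalised ground state `ψ` of `hubbardTorus 2 L 1 0` in that sector
(the free sector ground spaces are degenerate — open shells — and `ψ` is ANY vector in them) and every `ε > 0`:
`T_ε(ψ) = Σ_{m ≠ 0, |q_m| ≤ ε} S_ψ(m) ≤ 113 · ε² · L²`
(`free_windowSum_le_card`; the window is empty below `ε < 2π/L` and has `≤ (2⌊εL/2π⌋+1)² ≤ 9(εL/2π)²` points
above, `card_window_le`; `450 · 9/(4π²) < 113`). This is the crux's window functional with the crux's rate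
`C ε L²` improved to the metallic `C ε² L²`, uniformly in the filling. Bardeen–Cooper–Schrieffer (1957) §II;
Yang, Rev. Mod. Phys. 34 (1962) 694, §3. [folklore] -/
theorem windowInfraredBound_free_allGroundStates (hL : 3 ≤ L) {N : ℕ} {M : ℝ}
    {ψ : Fock (Orb (FermionTorus 2 L))} (hψ : IsGroundStateInSector (hubbardTorus 2 L 1 0) N M ψ)
    (hψ1 : star ψ ⬝ᵥ ψ = 1) {ε : ℝ} (hε : 0 < ε) :
    (∑ m : TorusSite 2 L, if m ≠ 0 ∧ momentumNormSq L m ≤ ε ^ 2 then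
        pairStructureFactor dWaveFormFactor L ψ m else 0) ≤ 113 * ε ^ 2 * (L : ℝ) ^ 2 := by
  classical
  have hLpos : (0 : ℝ) < L := Nat.cast_pos.2 (Nat.pos_of_ne_zero (NeZero.ne L))
  have hπ : (3 : ℝ) < Real.pi := Real.pi_gt_three
  set J : ℕ := ⌊ε * L / (2 * Real.pi)⌋₊ with hJ
  rcases Nat.eq_zero_or_pos J with hJ0 | hJpos
  · -- empty window: `εL/2π < 1`
    have hlt : ε * L / (2 * Real.pi) < 1 := by
      have := Nat.lt_floor_add_one (ε * L / (2 * Real.pi))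
      rw [← hJ, hJ0] at this
      simpa using this
    have hε2 : ε ^ 2 < (2 * Real.pi / (L : ℝ)) ^ 2 := by
      have h1 : ε < 2 * Real.pi / L := by
        rw [lt_div_iff₀ hLpos]
        rw [div_lt_one (by positivity)] at hlt
        exact hlt
      exact pow_lt_pow_left₀ h1 hε.le two_ne_zero
    have h0 : (∑ m : TorusSite 2 L, if m ≠ 0 ∧ momentumNormSq L m ≤ ε ^ 2 then
        pairStructureFactor dWaveFormFactor L ψ m else 0) = 0 := by
      refine Finset.sum_eq_zero fun m _ => ?_
      rw [if_neg]
      rintro ⟨hm, hle⟩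
      have h1 := one_le_sum_valMinAbs_sq L hm
      rw [momentumNormSq_apply] at hle
      have : (2 * Real.pi / (L : ℝ)) ^ 2 ≤ ε ^ 2 :=
        le_trans (by nlinarith [sq_nonneg (2 * Real.pi / (L : ℝ))]) hle
      linarith
    rw [h0]; positivity
  · -- `J ≥ 1`: `#window ≤ (2J+1)² ≤ 9J² ≤ 9(εL/2π)²`
    have hcard := card_window_le (L := L) hε.le
    have hJle : (J : ℝ) ≤ ε * L / (2 * Real.pi) := Nat.floor_le (by positivity)
    have hJ1 : (1 : ℝ) ≤ J := by exact_mod_cast hJpos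
    have hwin : (((Finset.univ.filter fun m : TorusSite 2 L => momentumNormSq L m ≤ ε ^ 2).card : ℕ) : ℝ) ≤
        (2 * J + 1 : ℝ) ^ 2 := by
      have : (Finset.univ.filter fun m : TorusSite 2 L => momentumNormSq L m ≤ ε ^ 2) =
          (Finset.univ.filter fun m : Fin 2 → ZMod L =>
            (2 * Real.pi / (L : ℝ)) ^ 2 * (∑ i : Fin 2, (((m i).valMinAbs : ℤ) : ℝ) ^ 2) ≤ ε ^ 2) := rfl
      rw [this]
      exact_mod_cast hcard
    refine (free_windowSum_le_card hL hψ hψ1 ε).trans ?_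
    have h9 : (2 * J + 1 : ℝ) ^ 2 ≤ 9 * (ε * L / (2 * Real.pi)) ^ 2 := by nlinarith
    have hx : 0 ≤ ε ^ 2 * (L : ℝ) ^ 2 := by positivity
    -- `(εL/2π)² · 4π² = ε² L²` and `4π² > 36`, so `450 · 9 (εL/2π)² ≤ 4050 ε²L²/36 ≤ 113 ε² L²`
    have hsq : (ε * L / (2 * Real.pi)) ^ 2 * (4 * Real.pi ^ 2) = ε ^ 2 * (L : ℝ) ^ 2 := by
      field_simp
      ring
    have h36 : (36 : ℝ) ≤ 4 * Real.pi ^ 2 := by nlinarith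
    have hkey : 450 * (9 * (ε * L / (2 * Real.pi)) ^ 2) ≤ 113 * ε ^ 2 * (L : ℝ) ^ 2 := by
      have hy : 0 ≤ (ε * L / (2 * Real.pi)) ^ 2 := sq_nonneg _
      nlinarith [mul_le_mul_of_nonneg_left h36 hy]
    nlinarith [hwin, h9, hkey]

/-- **The crux body at the free point is TRUE — for every filling and every ground state.** This is the
statement `Theses.FunctionFieldCertificate.WindowInfraredBound` with its leading `∀ U : ℝ, 0 < U →` replaced
by `U := 0` and the restriction `δ ∈ (0, 1/2)` dropped (the `let D`, the sector, the window and the functional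
are the crux's, verbatim): witnesses `C = 113`, `ε₀ = 1`, `L₀ = 3` (`windowInfraredBound_free_allGroundStates`,
`ε² ≤ ε` on `(0, 1]`). So the hypothesis `0 < U` of the crux is idle at the free point (contrast:
`WindowGap.Negative.not_windowGapAt_zero` — the sibling crux `WindowGap` is FALSE there), and the free anchor of
`Disproof.lean` §4.3 holds over the whole degenerate Slater ground space, not only along one Slater
determinant. (The statement is parenthesised as registered.) Bardeen–Cooper–Schrieffer (1957) §II; Yang,
Rev. Mod. Phys. 34 (1962) 694, §3. [folklore] -/
theorem windowInfraredBoundBody_at_zero : (∀ δ : ℝ, ∃ C ε₀ : ℝ, 0 ≤ C ∧ 0 < ε₀ ∧ ∃ L₀ : ℕ,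
    ∀ ε ∈ Set.Ioc (0:ℝ) ε₀, ∀ (L : ℕ) [NeZero L], L₀ ≤ L → Even L →
    let D : (Fin 2 → ZMod L) → Matrix (Finset (Literature.MathematicalPhysics.QuantumLattice.Orb
      (Literature.MathematicalPhysics.QuantumLattice.FermionTorus 2 L)))
      (Finset (Literature.MathematicalPhysics.QuantumLattice.Orb
        (Literature.MathematicalPhysics.QuantumLattice.FermionTorus 2 L))) ℂ :=
      fun m => ∑ x : Fin 2 → ZMod L, Complex.exp (-(2 * Real.pi * Complex.I *
        (((∑ i : Fin 2, m i * x i).val : ℕ) : ℂ) / (L : ℂ))) •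
          Literature.MathematicalPhysics.QuantumLattice.localPair
            Literature.MathematicalPhysics.QuantumLattice.dWaveFormFactor L x;
    ∀ ψ : Literature.MathematicalPhysics.QuantumLattice.Fock (Literature.MathematicalPhysics.QuantumLattice.Orb
      (Literature.MathematicalPhysics.QuantumLattice.FermionTorus 2 L)), star ψ ⬝ᵥ ψ = 1 →
      Literature.MathematicalPhysics.QuantumLattice.IsGroundStateInSector
        (Literature.MathematicalPhysics.QuantumLattice.hubbardTorus 2 L 1 0) (2 * ⌊(1 - δ) * (L : ℝ) ^ 2 / 2⌋₊) 0 ψ →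
      (∑ m : Fin 2 → ZMod L, if m ≠ 0 ∧ (2 * Real.pi / (L : ℝ)) ^ 2 *
          (∑ i : Fin 2, (((m i).valMinAbs : ℤ) : ℝ) ^ 2) ≤ ε ^ 2 then
        (star (Matrix.mulVec (D m) ψ) ⬝ᵥ Matrix.mulVec (D m) ψ).re / (L : ℝ) ^ 2 else 0) ≤
        C * ε * (L : ℝ) ^ 2) := by
  intro δ
  refine ⟨113, 1, by norm_num, one_pos, 3, ?_⟩
  intro ε hε L _ hL _ D ψ hψ1 hψ
  have h := windowInfraredBound_free_allGroundStates hL hψ hψ1 hε.1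
  have hεε : 113 * ε ^ 2 * (L : ℝ) ^ 2 ≤ 113 * ε * (L : ℝ) ^ 2 := by
    have : ε ^ 2 ≤ ε := by nlinarith [hε.1, hε.2]
    have hL2 : (0 : ℝ) ≤ (L : ℝ) ^ 2 := by positivity
    nlinarith
  exact h.trans hεε

end Window

end Summit.HubbardSuperconductivity.HubbardSuperconductivity.Theorems.WindowInfraredBound
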